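import Literature.Probability.Percolation.ConditionalPositiveAssociationProofs
import HarnessLib

/-!
# Observer events: the cluster of an observer `o` in BHK's restricted percolation `G[U]`

Helper file 1/3 for the crux `PercNearOneGluing.AdditiveGluing` (stmt-CriticalPhenomena-4576), line
`subuniform-dead-pocket-maximum`, stub `stub_goodStep` (siege k = 12, variation "Harris / FKG
monotone-coupling decomposition").  Lands with `--supports stmt-CriticalPhenomena-4576`.

No new definitions (local notations only).  Content: in van den Berg–Häggström–Kahn's restricted setting (`BHK2006.rC/rD/rS`, percolation on the
pairs inside `U`), the vertex cluster `obsK[U, o, ω]` of an OBSERVER `o`, the OBSERVER EVENT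
`obsE[U, o, T, R] = {C_o meets T} ∪ {C_o ∈ R}` (for a family `R` of vertex sets — an event that is neither
increasing nor decreasing), and two structural facts used by the observer-domination theorem
(file `…ObserverDomination`):
* `obs_mem_rE_iff_restrict` — the observer analogue of BHK's identity (6): conditioning on the layer
  `S` of `Z`, `E_{T,R}` becomes the event `E'_{(T∖Z) ∪ S, R_S}` OF THE SAME TYPE in `G[U ∖ Z]`
  (`R_S` = the sets avoiding `S`; first-entrance decomposition `obs_reach_dichotomy`);
* `obs_rK_inter_meeting_eq_iff`, `obs_rC_eq_of_rK_eq`, `obs_mem_rD_iff_of_rK_eq` — the exact cluster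
  `{C_o = W}` is determined by the pairs meeting `W`, and on it (for `a ∉ W`) the cluster of `a` and
  the events `{a ↮ X}` are those of `G[U ∖ W]` (spatial Markov property, pointwise form).
-/

namespace Summit.CriticalPhenomena.PercolationContinuityZ3.Theorems

open Literature.Probability.Percolation BHK2006 DecisionTree
open scoped Classical

noncomputable section

variable {V : Type*}

/-! Local notations (no new definitions; the objects are spelled out at every use):
`obsK[U, o, ω]` — the open vertex cluster of the OBSERVER `o` for percolation restricted to `U`;
`obsE[U, o, T, R]` — the OBSERVER EVENT `{C_o meets T} ∪ {C_o ∈ R}` for a family `R` of vertex sets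
(neither increasing nor decreasing); `obsFam[R, S]` — the sets of `R` avoiding `S`;
`obsBlockE[w, U', a, o, H, B, T, R, S]` — the block expectation
`E'[H(C_a) · 1(E'_{T ∪ S, R_S}) · 1{a ↮ B ∪ S}]` in `G[U']` (cf. `BHK2006.blockE`). -/
local notation3 (prettyPrint := false) "obsK[" U ", " o ", " ω "]" =>
  openCluster ((ω : Set (Sym2 _)) ∩ edgesIn U) o
local notation3 (prettyPrint := false) "obsE[" U ", " o ", " T ", " R "]" =>
  {ω : Set (Sym2 _) | (∃ t ∈ (T : Set _), (openGraph (ω ∩ edgesIn U)).Reachable o t) ∨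
    ∃ W ∈ (R : Set (Finset _)), openCluster (ω ∩ edgesIn U) o = ((W : Finset _) : Set _)}
local notation3 (prettyPrint := false) "obsFam[" R ", " S "]" =>
  {W : Finset _ | W ∈ (R : Set (Finset _)) ∧ ∀ n ∈ (S : Set _), n ∉ W}
local notation3 (prettyPrint := false) "obsBlockE[" w ", " U' ", " a ", " o ", " H ", " B ", " T ", " R ", " S "]" =>
  ∑ ω, weight w ω * ((H : Set (Sym2 _) → ℝ) (rC U' a ω) *
    ind obsE[U', o, (T : Set _) ∪ (S : Set _), obsFam[R, S]] ω * ind (rD U' a ((B : Set _) ∪ S)) ω)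

/-! ### The observer's cluster and the observer event in `G[U]` -/

/-- Unfolding of the observer's cluster `obsK[U, o, ω]`. [folklore] -/
theorem obs_mem_rK_iff {U : Finset V} {o v : V} {ω : Set (Sym2 V)} :
    v ∈ obsK[U, o, ω] ↔ (openGraph (ω ∩ edgesIn U)).Reachable o v := Iff.rfl

/-- `o ∈ C_o`. [folklore] -/
theorem obs_self_mem_rK (U : Finset V) (o : V) (ω : Set (Sym2 V)) : o ∈ obsK[U, o, ω] :=
  SimpleGraph.Reachable.refl o

/-- If `o ∈ T` the observer event is sure. [folklore] -/
theorem obs_rE_eq_univ_of_mem {U : Finset V} {o : V} {T : Set V} (R : Set (Finset V)) (ho : o ∈ T) :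
    obsE[U, o, T, R] = Set.univ :=
  Set.eq_univ_of_forall fun _ => Or.inl ⟨o, ho, SimpleGraph.Reachable.refl o⟩

/-- Monotonicity of the observer event: enlarging the target set, and replacing the family by one
that contains every old set not meeting the new target. [folklore] -/
theorem obs_rE_mono {U : Finset V} {o : V} {T₁ T₂ : Set V} {R₁ R₂ : Set (Finset V)} (hT : T₁ ⊆ T₂)
    (hR : ∀ W ∈ R₁, W ∈ R₂ ∨ ∃ t ∈ T₂, t ∈ W) : obsE[U, o, T₁, R₁] ⊆ obsE[U, o, T₂, R₂] := by
  rintro ω (⟨t, ht, hr⟩ | ⟨W, hW, hK⟩)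
  · exact Or.inl ⟨t, hT ht, hr⟩
  · rcases hR W hW with h | ⟨t, ht, htW⟩
    · exact Or.inr ⟨W, h, hK⟩
    · refine Or.inl ⟨t, ht, ?_⟩
      have : t ∈ obsK[U, o, ω] := by rw [hK]; exact_mod_cast htW
      exact this

/-- `obsFam[R, S] ⊆ R`. [folklore] -/
theorem obs_famR_subset (R : Set (Finset V)) (S : Set V) : obsFam[R, S] ⊆ R := fun _ h => h.1

/-- The observer event of `G[U ∖ Z]` does not depend on the pairs meeting `Z`. [folklore] -/
theorem obs_mem_rE_diff_meeting (U Z : Finset V) (o : V) (T : Set V) (R : Set (Finset V))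
    (ω : Set (Sym2 V)) : ω \ meeting Z ∈ obsE[U \ Z, o, T, R] ↔ ω ∈ obsE[U \ Z, o, T, R] := by
  simp only [Set.mem_setOf_eq, diff_meeting_inter_edgesIn]

/-- `obsK` of `G[U ∖ Z]` does not depend on the pairs meeting `Z`. [folklore] -/
theorem obs_rK_diff_meeting (U Z : Finset V) (o : V) (ω : Set (Sym2 V)) :
    obsK[U \ Z, o, ω \ meeting Z] = obsK[U \ Z, o, ω] := by
  simp only [diff_meeting_inter_edgesIn]

/-- Reachability in `G[U']` implies reachability in `G[U]` for `U' ⊆ U`. [folklore] -/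
theorem obs_reach_mono_set {U U' : Finset V} (h : U' ⊆ U) {ω : Set (Sym2 V)} {x y : V}
    (hr : (openGraph (ω ∩ edgesIn U')).Reachable x y) : (openGraph (ω ∩ edgesIn U)).Reachable x y :=
  hr.mono (openGraph_le (Set.inter_subset_inter_right _ (edgesIn_mono h)))

/-- FIRST ENTRANCE INTO `Z`: a vertex joined to `o ∉ Z` in `G[U]` is either joined to `o` in
`G[U ∖ Z]` (and lies outside `Z`), or `o` is joined in `G[U ∖ Z]` to a vertex of BHK's layer
`S = rS U Z ω` (a vertex outside `Z` with an open pair to `Z`).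
[cite: VandenbergHaggstromKahn2005, §1 p. 4, identity (6) (the same first-entrance argument)] -/
theorem obs_reach_dichotomy {U Z : Finset V} {o : V} (ho : o ∉ Z) {ω : Set (Sym2 V)} {v : V}
    (hv : (openGraph (ω ∩ edgesIn U)).Reachable o v) :
    (v ∉ Z ∧ (openGraph (ω ∩ edgesIn (U \ Z))).Reachable o v) ∨
      ∃ n ∈ rS U Z ω, (openGraph (ω ∩ edgesIn (U \ Z))).Reachable o n := by
  rw [SimpleGraph.reachable_iff_reflTransGen] at hv
  induction hv with
  | refl => exact Or.inl ⟨ho, SimpleGraph.Reachable.refl o⟩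
  | @tail b c _ hbc ih =>
    rcases ih with ⟨hbZ, hb⟩ | h
    · obtain ⟨hω, ⟨hbU, hcU⟩, hne⟩ := adj_iff.1 hbc
      by_cases hcZ : c ∈ Z
      · exact Or.inr ⟨b, ⟨Finset.mem_sdiff.2 ⟨hbU, hbZ⟩, c, hcZ, hω⟩, hb⟩
      · refine Or.inl ⟨hcZ, hb.trans (SimpleGraph.Adj.reachable ?_)⟩
        exact adj_iff.2 ⟨hω, ⟨Finset.mem_sdiff.2 ⟨hbU, hbZ⟩, Finset.mem_sdiff.2 ⟨hcU, hcZ⟩⟩, hne⟩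
    · exact Or.inr h

/-- **Reduction of the observer event to `G[U ∖ Z]` given the layer of `Z`** (the observer analogue
of BHK's identity (6)): for `o ∉ Z ⊆ T` and a family avoiding `Z`,
`E_{T,R}` in `G[U]` is the event `E'_{(T∖Z) ∪ S, R_S}` of `G[U ∖ Z]`, where `S = rS U Z ω` is the
layer and `R_S` the sets of `R` avoiding `S`.
[new; cf. VandenbergHaggstromKahn2005, §1 p. 4, identity (6)] -/
theorem obs_mem_rE_iff_restrict {U Z : Finset V} (hZU : Z ⊆ U) {o : V} (ho : o ∉ Z) {T : Set V}
    (hZT : (↑Z : Set V) ⊆ T) {R : Set (Finset V)} (hR : ∀ W ∈ R, ∀ z ∈ Z, z ∉ W)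
    (ω : Set (Sym2 V)) :
    ω ∈ obsE[U, o, T, R] ↔
      ω ∈ obsE[U \ Z, o, (T \ ↑Z) ∪ rS U Z ω, obsFam[R, rS U Z ω]] := by
  constructor
  · rintro (⟨t, ht, hr⟩ | ⟨W, hW, hK⟩)
    · -- `o ↔ t ∈ T`: first entrance into `Z`
      rcases obs_reach_dichotomy ho hr with ⟨htZ, hr'⟩ | ⟨m, hm, hr'⟩
      · exact Or.inl ⟨t, Or.inl ⟨ht, htZ⟩, hr'⟩
      · exact Or.inl ⟨m, Or.inr hm, hr'⟩
    · -- `C_o = W ∈ R`: the cluster avoids `Z`, hence equals the cluster in `G[U ∖ Z]`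
      have hWZ : ∀ v ∈ obsK[U, o, ω], v ∉ Z := fun v hv hvZ => by
        rw [hK] at hv; exact hR W hW v hvZ (by exact_mod_cast hv)
      have hnoS : ∀ m ∈ rS U Z ω, m ∉ obsK[U, o, ω] := by
        rintro m ⟨hmUZ, z, hz, hmz⟩ hm
        obtain ⟨hmU, hmZ⟩ := Finset.mem_sdiff.1 hmUZ
        have hz' : z ∈ obsK[U, o, ω] := by
          refine (obs_mem_rK_iff.1 hm).trans (SimpleGraph.Adj.reachable (adj_iff.2 ⟨hmz, ⟨hmU, hZU hz⟩, ?_⟩))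
          rintro rfl; exact hmZ hz
        exact hWZ z hz' hz
      have hKK : obsK[U \ Z, o, ω] = obsK[U, o, ω] := by
        ext v
        refine ⟨fun hv => obs_reach_mono_set Finset.sdiff_subset hv, fun hv => ?_⟩
        rcases obs_reach_dichotomy ho (obs_mem_rK_iff.1 hv) with ⟨-, h⟩ | ⟨m, hm, hr'⟩
        · exact h
        · exact absurd (obs_reach_mono_set Finset.sdiff_subset hr' : m ∈ obsK[U, o, ω]) (hnoS m hm)
      refine Or.inr ⟨W, ⟨hW, fun m hm hmW => hnoS m hm ?_⟩, by rw [hKK, hK]⟩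
      rw [hK]; exact_mod_cast hmW
  · rintro (⟨t, ht, hr⟩ | ⟨W, ⟨hW, hWS⟩, hK⟩)
    · rcases ht with ⟨htT, -⟩ | ⟨htUZ, z, hz, htz⟩
      · exact Or.inl ⟨t, htT, obs_reach_mono_set Finset.sdiff_subset hr⟩
      · obtain ⟨htU, htZ⟩ := Finset.mem_sdiff.1 htUZ
        refine Or.inl ⟨z, hZT hz, (obs_reach_mono_set Finset.sdiff_subset hr).trans
          (SimpleGraph.Adj.reachable (adj_iff.2 ⟨htz, ⟨htU, hZU hz⟩, ?_⟩))⟩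
        rintro rfl; exact htZ hz
    · -- `C'_o = W` with `W` avoiding the layer: then `C_o = W` in `G[U]`
      refine Or.inr ⟨W, hW, ?_⟩
      ext v
      refine ⟨fun hv => ?_, fun hv => ?_⟩
      · rcases obs_reach_dichotomy ho (obs_mem_rK_iff.1 hv) with ⟨-, h⟩ | ⟨m, hm, hr'⟩
        · have : v ∈ obsK[U \ Z, o, ω] := h
          rwa [hK] at this
        · have hm' : m ∈ obsK[U \ Z, o, ω] := hr'
          rw [hK] at hm'
          exact absurd (by exact_mod_cast hm') (hWS m hm)
      · have hv' : v ∈ obsK[U \ Z, o, ω] := by rw [hK]; exact hv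
        exact obs_reach_mono_set Finset.sdiff_subset hv'

/-! ### The exact cluster of the observer -/

/-- If `C_o = W` in `G[U]`, the open paths from `o` use only pairs meeting `W`, so `C_o = W` also
for the configuration restricted to the pairs meeting `W`. [folklore] -/
theorem obs_rK_inter_meeting_of_eq {U : Finset V} {o : V} {W : Finset V} {ω : Set (Sym2 V)}
    (h : obsK[U, o, ω] = ↑W) : obsK[U, o, ω ∩ meeting W] = ↑W := by
  apply Set.Subset.antisymm
  · rw [← h]
    exact fun v hv => obs_reach_mono_set le_rfl
      ((obs_mem_rK_iff.1 hv).mono (openGraph_le (Set.inter_subset_inter_left _ Set.inter_subset_left)))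
  · intro v hv
    have hv' : v ∈ obsK[U, o, ω] := by rw [h]; exact hv
    have hr := obs_mem_rK_iff.1 hv'
    rw [SimpleGraph.reachable_iff_reflTransGen] at hr
    -- every vertex on the path is in `W`, so every pair used meets `W`
    suffices H : (openGraph (ω ∩ meeting W ∩ edgesIn U)).Reachable o v from H
    clear hv hv'
    induction hr with
    | refl => exact SimpleGraph.Reachable.refl o
    | @tail b c hob hbc ih =>
      obtain ⟨hω, hbcU, hne⟩ := adj_iff.1 hbc
      have hb : b ∈ (↑W : Set V) := by
        rw [← h]; exact (SimpleGraph.reachable_iff_reflTransGen _ _).2 hob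
      refine ih.trans (SimpleGraph.Adj.reachable (adj_iff.2 ⟨⟨hω, b, ?_, Sym2.mem_mk_left b c⟩,
        hbcU, hne⟩))
      exact_mod_cast hb

/-- Conversely, if `C_o = W` for the configuration restricted to the pairs meeting `W`, then
`C_o = W`: an open path from `o` never leaves `W`. [folklore] -/
theorem obs_rK_eq_of_inter_meeting {U : Finset V} {o : V} {W : Finset V} {ω : Set (Sym2 V)}
    (h : obsK[U, o, ω ∩ meeting W] = ↑W) : obsK[U, o, ω] = ↑W := by
  apply Set.Subset.antisymm
  · intro v hv
    have hr := obs_mem_rK_iff.1 hv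
    rw [SimpleGraph.reachable_iff_reflTransGen] at hr
    suffices H : (openGraph (ω ∩ meeting W ∩ edgesIn U)).Reachable o v by
      have : v ∈ obsK[U, o, ω ∩ meeting W] := H
      rwa [h] at this
    clear hv
    induction hr with
    | refl => exact SimpleGraph.Reachable.refl o
    | @tail b c _ hbc ih =>
      obtain ⟨hω, hbcU, hne⟩ := adj_iff.1 hbc
      have hb : b ∈ (↑W : Set V) := by
        rw [← h]; exact ih
      refine ih.trans (SimpleGraph.Adj.reachable (adj_iff.2 ⟨⟨hω, b, ?_, Sym2.mem_mk_left b c⟩,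
        hbcU, hne⟩))
      exact_mod_cast hb
  · rw [← h]
    exact fun v hv => (obs_mem_rK_iff.1 hv).mono
      (openGraph_le (Set.inter_subset_inter_left _ Set.inter_subset_left))

/-- `{C_o = W}` is determined by the pairs meeting `W`. [folklore] -/
theorem obs_rK_inter_meeting_eq_iff {U : Finset V} {o : V} {W : Finset V} (ω : Set (Sym2 V)) :
    obsK[U, o, ω ∩ meeting W] = ↑W ↔ obsK[U, o, ω] = ↑W :=
  ⟨obs_rK_eq_of_inter_meeting, obs_rK_inter_meeting_of_eq⟩

/-- On `{C_o = W}` with `a ∉ W`, no vertex of the layer of `W` is joined to `a` in `G[U ∖ W]` — in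
fact the layer is empty: a vertex with an open pair into `W = C_o` belongs to `C_o`. [folklore] -/
theorem obs_rS_false_of_rK_eq {U : Finset V} {o : V} {W : Finset V} (hWU : W ⊆ U) {ω : Set (Sym2 V)}
    (h : obsK[U, o, ω] = ↑W) {m : V} (hm : m ∈ rS U W ω) : False := by
  obtain ⟨hmUW, z, hz, hmz⟩ := hm
  obtain ⟨hmU, hmW⟩ := Finset.mem_sdiff.1 hmUW
  have hz' : z ∈ obsK[U, o, ω] := by rw [h]; exact_mod_cast hz
  have : m ∈ obsK[U, o, ω] := by
    refine (obs_mem_rK_iff.1 hz').trans (SimpleGraph.Adj.reachable (adj_iff.2 ⟨?_, ⟨hWU hz, hmU⟩, ?_⟩))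
    · rw [Sym2.eq_swap]; exact hmz
    · rintro rfl; exact hmW hz
  rw [h] at this
  exact hmW (by exact_mod_cast this)

/-- On `{C_o = W}` with `a ∉ W ⊆ U`, the edge cluster of `a` in `G[U]` is its cluster in
`G[U ∖ W]`. [folklore; BHK2006.rC_restrict] -/
theorem obs_rC_eq_of_rK_eq {U : Finset V} {o a : V} {W : Finset V} (hWU : W ⊆ U) (ha : a ∉ W)
    {ω : Set (Sym2 V)} (h : obsK[U, o, ω] = ↑W) : rC U a ω = rC (U \ W) a ω :=
  rC_restrict ha fun _ hm _ => obs_rS_false_of_rK_eq hWU h hm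

/-- On `{C_o = W}` with `a ∉ W ⊆ U`, `{a ↮ X in G[U]} = {a ↮ X in G[U ∖ W]}`.
[folklore; BHK2006.reach_restrict] -/
theorem obs_mem_rD_iff_of_rK_eq {U : Finset V} {o a : V} {W : Finset V} (hWU : W ⊆ U) (ha : a ∉ W)
    {ω : Set (Sym2 V)} (h : obsK[U, o, ω] = ↑W) (X : Set V) : ω ∈ rD U a X ↔ ω ∈ rD (U \ W) a X := by
  refine ⟨fun hD x hx hr => hD x hx (obs_reach_mono_set Finset.sdiff_subset hr), fun hD x hx hr => ?_⟩
  exact hD x hx (reach_restrict ha (fun _ hm _ => obs_rS_false_of_rK_eq hWU h hm) hr).2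


/-- Registered sub-goal `stub_obsEventRestrict_k12` (siege k12, `--supports stmt-CriticalPhenomena-4576`):
the reduction of the observer event to `G[U ∖ Z]` given the layer of `Z` (`obs_mem_rE_iff_restrict`),
universe `Type`. [new; cf. VandenbergHaggstromKahn2005, §1 p. 4, identity (6)] -/
theorem stub_obsEventRestrict_k12 : ∀ (V : Type) (U Z : Finset V), Z ⊆ U → ∀ (o : V), o ∉ Z → ∀ (T : Set V), (↑Z : Set V) ⊆ T → ∀ (R : Set (Finset V)), (∀ W ∈ R, ∀ z ∈ Z, z ∉ W) → ∀ (ω : Set (Sym2 V)), (ω ∈ {ω : Set (Sym2 V) | (∃ t ∈ T, (openGraph (ω ∩ BHK2006.edgesIn U)).Reachable o t) ∨ ∃ W ∈ R, openCluster (ω ∩ BHK2006.edgesIn U) o = ((W : Finset V) : Set V)} ↔ ω ∈ {ω' : Set (Sym2 V) | (∃ t ∈ ((T \ ↑Z) ∪ BHK2006.rS U Z ω), (openGraph (ω' ∩ BHK2006.edgesIn (U \ Z))).Reachable o t) ∨ ∃ W ∈ {W : Finset V | W ∈ R ∧ ∀ n ∈ BHK2006.rS U Z ω, n ∉ W}, openCluster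 (ω' ∩ BHK2006.edgesIn (U \ Z)) o = ((W : Finset V) : Set V)}) :=
  fun _ _ _ hZU _ ho _ hZT _ hR ω => obs_mem_rE_iff_restrict hZU ho hZT hR ω

end

end Summit.CriticalPhenomena.PercolationContinuityZ3.Theorems
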